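import Summits.AtomisticToContinuum.BoseEinsteinCondensation.Theorems.BECCutLineWeakDisorderGroundStateRigidityStubCompactness
import Summits.AtomisticToContinuum.BoseEinsteinCondensation.Theorems.BECCutLineWeakDisorderGroundStateRigidityStubRigidityOfUnique
import Summits.AtomisticToContinuum.BoseEinsteinCondensation.Theorems.BECCutLineWeakDisorderGroundStateRigidityStubExistsNonnegGroundState
import HarnessLib

/-!
# Crux `GroundStateRigidity` (stmt-AtomisticToContinuum-9072), line `Sketch`: rigidity of near-minimisers
# IMPLIES nondegeneracy of the closed-form ground state (the converse of `stub_rigidityOfUnique`)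

Route `BECCutLineWeakDisorder` (decl shared verbatim by 8 routes).  Lead c1 of line `Sketch`, 2026-08-16.
Supports (does not close) stmt-AtomisticToContinuum-9072; registered stub `hasUniqueGroundState_of_rigid`.

With `stub_rigidityOfUnique` (p99394: uniqueness ⇒ rigidity) this makes the local form of the crux at a box
`(v, N, L)` with `E₀(N, L) < ⊤` EQUIVALENT to `HasUniqueGroundState v N L`; so promoting the open kernel
`stub_uniquenessKernel` (eventual uniqueness at low density for essentially unbounded `v`) to an item loses nothing:
modulo the landed `stub_finiteEnergyLowDensity` it IS the crux.

Proof (`hasUniqueGroundState_of_rigid`): existence of a nonnegative ground state is `stub_existsNonnegGroundState`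
(fed with `stub_compactness`).  Uniqueness: a closed-form ground state `Ψ` has, for every slack `δ > 0` and every
`ε > 0`, a trial state `T` with `energy T ≤ E₀ + δ` and `∫|T − Ψ|² ≤ ε` (`exists_trialState_near`: the closed energy
is an infimum of `liminf`s along `L²`-approximating sequences).  Given two ground states `Ψ, Φ`, pick for each `k` the
slack `δ_k` of rigidity at `η = 1/(k+1)`, approximants `T_k → Φ`, `S_k → Ψ` at that slack and tolerance `1/(k+1)`, and
unit constants `c_k` with `∫|T_k − c_k S_k|² ≤ 1/(k+1)`; along a subsequence `c_k → c` on the (compact) unit circle, and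
`∫|Φ − cΨ|² ≤ 4(∫|Φ − T_k|² + ∫|T_k − c_kS_k|² + ∫|S_k − Ψ|² + |c_k − c|²) → 0`, so `Φ = cΨ` a.e.
-/

noncomputable section

open MeasureTheory Filter Metric Set
open scoped ENNReal NNReal Topology

namespace Summit.AtomisticToContinuum.BoseEinsteinCondensation.Theorems.GroundStateRigidity

open Literature.MathematicalPhysics.QuantumManyBody.BoseGas

variable {N : ℕ}

/-- **Near-minimising trial states close to a ground state**: a closed-form ground state `Ψ` is, for every
slack `δ > 0` and tolerance `ε > 0`, within `ε` in `L²` (squared) of a trial state of energy `≤ E₀ + δ`. -/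
theorem exists_trialState_near {v : ℝ → ℝ≥0∞} {L : ℝ} {Ψ : Config N → ℂ} (hΨ : IsGroundState v L Ψ)
    {δ : ℝ≥0∞} (hδ : 0 < δ) {ε : ℝ≥0∞} (hε : 0 < ε) :
    ∃ T : TrialState N L, energy v T ≤ groundStateEnergy v N L + δ ∧
      ∫⁻ X, (‖T.ψ X - Ψ X‖₊ : ℝ≥0∞) ^ 2 ≤ ε := by
  have hE : groundStateEnergy v N L ≠ ⊤ := hΨ.groundStateEnergy_ne_top
  have hlt : closedEnergy v L Ψ < groundStateEnergy v N L + δ := by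
    rw [hΨ.closedEnergy_eq]
    exact ENNReal.lt_add_right hE hδ.ne'
  unfold closedEnergy at hlt
  obtain ⟨Φ, hΦ⟩ := iInf_lt_iff.1 hlt
  obtain ⟨hT, hlim⟩ := iInf_lt_iff.1 hΦ
  have hfreq : ∃ᶠ n in atTop, energy v (Φ n) < groundStateEnergy v N L + δ :=
    frequently_lt_of_liminf_lt (by isBoundedDefault) hlim
  have hev : ∀ᶠ n in atTop, ∫⁻ X, (‖(Φ n).ψ X - Ψ X‖₊ : ℝ≥0∞) ^ 2 < ε :=
    (hT.eventually (Iio_mem_nhds hε))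
  obtain ⟨n, hn1, hn2⟩ := (hfreq.and_eventually hev).exists
  exact ⟨Φ n, hn1.le, hn2.le⟩

/-- `|a + b + c + d|² ≤ 4 (|a|² + |b|² + |c|² + |d|²)` in `ℝ≥0∞` (parallelogram bound twice). -/
theorem coe_nnnorm_add_four_sq_le (a b c d : ℂ) :
    (‖a + b + c + d‖₊ : ℝ≥0∞) ^ 2 ≤ 4 * ((‖a‖₊ : ℝ≥0∞) ^ 2 + (‖b‖₊ : ℝ≥0∞) ^ 2 +
      (‖c‖₊ : ℝ≥0∞) ^ 2 + (‖d‖₊ : ℝ≥0∞) ^ 2) := by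
  have h1 := coe_nnnorm_add_sq_le (a + b) (c + d)
  have h2 := coe_nnnorm_add_sq_le a b
  have h3 := coe_nnnorm_add_sq_le c d
  calc (‖a + b + c + d‖₊ : ℝ≥0∞) ^ 2 = (‖(a + b) + (c + d)‖₊ : ℝ≥0∞) ^ 2 := by rw [add_assoc]
    _ ≤ 2 * (‖a + b‖₊ : ℝ≥0∞) ^ 2 + 2 * (‖c + d‖₊ : ℝ≥0∞) ^ 2 := h1
    _ ≤ 2 * (2 * (‖a‖₊ : ℝ≥0∞) ^ 2 + 2 * (‖b‖₊ : ℝ≥0∞) ^ 2) +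
        2 * (2 * (‖c‖₊ : ℝ≥0∞) ^ 2 + 2 * (‖d‖₊ : ℝ≥0∞) ^ 2) := by gcongr
    _ = 4 * ((‖a‖₊ : ℝ≥0∞) ^ 2 + (‖b‖₊ : ℝ≥0∞) ^ 2 +
      (‖c‖₊ : ℝ≥0∞) ^ 2 + (‖d‖₊ : ℝ≥0∞) ^ 2) := by ring

/-- **The four-term `L²` bound** used to pass to the limit: for trial states `T, S`, measurable `Ψ, Φ` with
`∫|Ψ|² = 1`, a unit constant `c'` and any constant `c`,
`∫|Φ − cΨ|² ≤ 4(∫|Φ − T|² + ∫|T − c'S|² + ∫|S − Ψ|² + |c' − c|²)`. -/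
theorem lintegral_sub_const_mul_sq_le_four {L : ℝ} (T S : TrialState N L) {Ψ Φ : Config N → ℂ}
    (hΨm : Measurable Ψ) (hΦm : Measurable Φ) (hΨ1 : ∫⁻ X, (‖Ψ X‖₊ : ℝ≥0∞) ^ 2 = 1)
    {c' : ℂ} (hc' : ‖c'‖ = 1) (c : ℂ) :
    ∫⁻ X, (‖Φ X - c * Ψ X‖₊ : ℝ≥0∞) ^ 2 ≤
      4 * ((∫⁻ X, (‖Φ X - T.ψ X‖₊ : ℝ≥0∞) ^ 2) + (∫⁻ X, (‖T.ψ X - c' * S.ψ X‖₊ : ℝ≥0∞) ^ 2) +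
        (∫⁻ X, (‖S.ψ X - Ψ X‖₊ : ℝ≥0∞) ^ 2) + (‖c' - c‖₊ : ℝ≥0∞) ^ 2) := by
  have hTm : Measurable T.ψ := T.contDiff.continuous.measurable
  have hSm : Measurable S.ψ := S.contDiff.continuous.measurable
  -- pointwise four-term bound
  have hpt : ∀ X, (‖Φ X - c * Ψ X‖₊ : ℝ≥0∞) ^ 2 ≤
      4 * ((‖Φ X - T.ψ X‖₊ : ℝ≥0∞) ^ 2 + (‖T.ψ X - c' * S.ψ X‖₊ : ℝ≥0∞) ^ 2 +
        (‖S.ψ X - Ψ X‖₊ : ℝ≥0∞) ^ 2 + (‖c' - c‖₊ : ℝ≥0∞) ^ 2 * (‖Ψ X‖₊ : ℝ≥0∞) ^ 2) := by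
    intro X
    have hdecomp : Φ X - c * Ψ X =
        (Φ X - T.ψ X) + (T.ψ X - c' * S.ψ X) + c' * (S.ψ X - Ψ X) + (c' - c) * Ψ X := by ring
    have h3 : (‖c' * (S.ψ X - Ψ X)‖₊ : ℝ≥0∞) ^ 2 = (‖S.ψ X - Ψ X‖₊ : ℝ≥0∞) ^ 2 := by
      rw [nnnorm_mul, ENNReal.coe_mul, mul_pow, coe_nnnorm_eq_one_of_norm_eq_one hc', one_pow, one_mul]
    have h4 : (‖(c' - c) * Ψ X‖₊ : ℝ≥0∞) ^ 2 = (‖c' - c‖₊ : ℝ≥0∞) ^ 2 * (‖Ψ X‖₊ : ℝ≥0∞) ^ 2 := by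
      rw [nnnorm_mul, ENNReal.coe_mul, mul_pow]
    rw [hdecomp]
    refine (coe_nnnorm_add_four_sq_le _ _ _ _).trans ?_
    rw [h3, h4]
  -- integrate
  have hm1 : Measurable fun X => (‖Φ X - T.ψ X‖₊ : ℝ≥0∞) ^ 2 :=
    ((hΦm.sub hTm).nnnorm.coe_nnreal_ennreal).pow_const 2
  have hm2 : Measurable fun X => (‖T.ψ X - c' * S.ψ X‖₊ : ℝ≥0∞) ^ 2 :=
    ((hTm.sub (measurable_const.mul hSm)).nnnorm.coe_nnreal_ennreal).pow_const 2
  have hm3 : Measurable fun X => (‖S.ψ X - Ψ X‖₊ : ℝ≥0∞) ^ 2 :=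
    ((hSm.sub hΨm).nnnorm.coe_nnreal_ennreal).pow_const 2
  have hm4 : Measurable fun X => (‖c' - c‖₊ : ℝ≥0∞) ^ 2 * (‖Ψ X‖₊ : ℝ≥0∞) ^ 2 :=
    measurable_const.mul ((hΨm.nnnorm.coe_nnreal_ennreal).pow_const 2)
  calc ∫⁻ X, (‖Φ X - c * Ψ X‖₊ : ℝ≥0∞) ^ 2
      ≤ ∫⁻ X, 4 * ((‖Φ X - T.ψ X‖₊ : ℝ≥0∞) ^ 2 + (‖T.ψ X - c' * S.ψ X‖₊ : ℝ≥0∞) ^ 2 +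
          (‖S.ψ X - Ψ X‖₊ : ℝ≥0∞) ^ 2 + (‖c' - c‖₊ : ℝ≥0∞) ^ 2 * (‖Ψ X‖₊ : ℝ≥0∞) ^ 2) :=
        lintegral_mono hpt
    _ = 4 * ∫⁻ X, ((‖Φ X - T.ψ X‖₊ : ℝ≥0∞) ^ 2 + (‖T.ψ X - c' * S.ψ X‖₊ : ℝ≥0∞) ^ 2 +
          (‖S.ψ X - Ψ X‖₊ : ℝ≥0∞) ^ 2 + (‖c' - c‖₊ : ℝ≥0∞) ^ 2 * (‖Ψ X‖₊ : ℝ≥0∞) ^ 2) :=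
        lintegral_const_mul' _ _ (by norm_num)
    _ = 4 * ((∫⁻ X, (‖Φ X - T.ψ X‖₊ : ℝ≥0∞) ^ 2) + (∫⁻ X, (‖T.ψ X - c' * S.ψ X‖₊ : ℝ≥0∞) ^ 2) +
          (∫⁻ X, (‖S.ψ X - Ψ X‖₊ : ℝ≥0∞) ^ 2) +
          ∫⁻ X, (‖c' - c‖₊ : ℝ≥0∞) ^ 2 * (‖Ψ X‖₊ : ℝ≥0∞) ^ 2) := by
        rw [lintegral_add_right _ hm4, lintegral_add_right _ hm3, lintegral_add_right _ hm2]
    _ = _ := by rw [lintegral_const_mul _ ((hΨm.nnnorm.coe_nnreal_ennreal).pow_const 2), hΨ1, mul_one]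

/-- **Rigidity of near-minimisers implies nondegeneracy of the closed-form ground state** (converse of
`stub_rigidityOfUnique`; registered stub `hasUniqueGroundState_of_rigid`).  If `E₀(N, L) < ⊤` and for every
`η > 0` some `δ > 0` makes any two `δ`-near-minimisers `η`-close in `L²` up to a phase, then a nonnegative
ground state exists (`stub_existsNonnegGroundState` + `stub_compactness`) and any two closed-form ground states are
proportional a.e. (approximate both by near-minimisers, `exists_trialState_near`; extract a convergent subsequence
of the phases on the compact unit circle; pass to the limit in the four-term bound
`lintegral_sub_const_mul_sq_le_four`).  Hence, with `stub_rigidityOfUnique`, at finite `E₀` the local form of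
the crux is EQUIVALENT to `HasUniqueGroundState`. [cite: ReedSimonIV1978, §XIII.12 Thm XIII.47] -/
theorem hasUniqueGroundState_of_rigid :
    ∀ (N : ℕ) (v : ℝ → ℝ≥0∞) (L : ℝ), groundStateEnergy v N L ≠ ⊤ →
      (∀ η : ℝ, 0 < η → ∃ δ : ℝ≥0∞, 0 < δ ∧ ∀ Ψ Φ : TrialState N L,
        energy v Ψ ≤ groundStateEnergy v N L + δ → energy v Φ ≤ groundStateEnergy v N L + δ →
        ∃ c : ℂ, ‖c‖ = 1 ∧ ∫⁻ X, (‖Ψ.ψ X - c * Φ.ψ X‖₊ : ℝ≥0∞) ^ 2 ≤ ENNReal.ofReal η) →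
      HasUniqueGroundState v N L := by
  intro N v L hE hR
  refine ⟨stub_existsNonnegGroundState stub_compactness N v L hE, fun Ψ Φ hΨ hΦ => ?_⟩
  -- tolerances `1/(k+1)`
  set tol : ℕ → ℝ≥0∞ := fun k => ENNReal.ofReal (1 / ((k : ℝ) + 1)) with htol
  have htol_pos : ∀ k, 0 < tol k := fun k => ENNReal.ofReal_pos.2 (by positivity)
  have htol_lim : Tendsto tol atTop (𝓝 0) := by
    have h := ENNReal.tendsto_ofReal (tendsto_one_div_add_atTop_nhds_zero_nat)
    rwa [ENNReal.ofReal_zero] at h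
  -- rigidity slack at `η = 1/(k+1)`, approximants, phases
  have hstep : ∀ k : ℕ, ∃ (T S : TrialState N L) (c : ℂ), ‖c‖ = 1 ∧
      ∫⁻ X, (‖T.ψ X - Φ X‖₊ : ℝ≥0∞) ^ 2 ≤ tol k ∧ ∫⁻ X, (‖S.ψ X - Ψ X‖₊ : ℝ≥0∞) ^ 2 ≤ tol k ∧
      ∫⁻ X, (‖T.ψ X - c * S.ψ X‖₊ : ℝ≥0∞) ^ 2 ≤ tol k := by
    intro k
    obtain ⟨δ, hδ, hδR⟩ := hR (1 / ((k : ℝ) + 1)) (by positivity)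
    obtain ⟨T, hTE, hTΦ⟩ := exists_trialState_near hΦ hδ (htol_pos k)
    obtain ⟨S, hSE, hSΨ⟩ := exists_trialState_near hΨ hδ (htol_pos k)
    obtain ⟨c, hc, hcTS⟩ := hδR T S hTE hSE
    exact ⟨T, S, c, hc, hTΦ, hSΨ, hcTS⟩
  choose T S c hc hTΦ hSΨ hTS using hstep
  -- a convergent subsequence of the phases on the unit circle
  have hcmem : ∀ k, c k ∈ Metric.sphere (0 : ℂ) 1 := fun k => by simp [hc k]
  obtain ⟨c₀, hc₀mem, φ, hφ, hφlim⟩ := (isCompact_sphere (0 : ℂ) 1).tendsto_subseq hcmem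
  have hc₀ : ‖c₀‖ = 1 := by simpa using hc₀mem
  refine ⟨c₀, hc₀, ?_⟩
  -- the four-term bound along the subsequence tends to `0`
  have hΨ1 : ∫⁻ X, (‖Ψ X‖₊ : ℝ≥0∞) ^ 2 = 1 := hΨ.norm_eq
  have hbound : ∀ k, ∫⁻ X, (‖Φ X - c₀ * Ψ X‖₊ : ℝ≥0∞) ^ 2 ≤
      4 * (tol (φ k) + tol (φ k) + tol (φ k) + (‖c (φ k) - c₀‖₊ : ℝ≥0∞) ^ 2) := by
    intro k
    have h1 : ∫⁻ X, (‖Φ X - (T (φ k)).ψ X‖₊ : ℝ≥0∞) ^ 2 ≤ tol (φ k) := by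
      refine le_of_eq_of_le (lintegral_congr fun X => ?_) (hTΦ (φ k))
      rw [← nnnorm_neg, neg_sub]
    have h2 : ∫⁻ X, (‖(T (φ k)).ψ X - c (φ k) * (S (φ k)).ψ X‖₊ : ℝ≥0∞) ^ 2 ≤ tol (φ k) := hTS (φ k)
    have h3 : ∫⁻ X, (‖(S (φ k)).ψ X - Ψ X‖₊ : ℝ≥0∞) ^ 2 ≤ tol (φ k) := hSΨ (φ k)
    calc ∫⁻ X, (‖Φ X - c₀ * Ψ X‖₊ : ℝ≥0∞) ^ 2
        ≤ 4 * ((∫⁻ X, (‖Φ X - (T (φ k)).ψ X‖₊ : ℝ≥0∞) ^ 2) +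
            (∫⁻ X, (‖(T (φ k)).ψ X - c (φ k) * (S (φ k)).ψ X‖₊ : ℝ≥0∞) ^ 2) +
            (∫⁻ X, (‖(S (φ k)).ψ X - Ψ X‖₊ : ℝ≥0∞) ^ 2) + (‖c (φ k) - c₀‖₊ : ℝ≥0∞) ^ 2) :=
          lintegral_sub_const_mul_sq_le_four (T (φ k)) (S (φ k)) hΨ.measurable hΦ.measurable hΨ1
            (hc (φ k)) c₀
      _ ≤ 4 * (tol (φ k) + tol (φ k) + tol (φ k) + (‖c (φ k) - c₀‖₊ : ℝ≥0∞) ^ 2) := by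
          gcongr
  have hlim : Tendsto (fun k => 4 * (tol (φ k) + tol (φ k) + tol (φ k) +
      (‖c (φ k) - c₀‖₊ : ℝ≥0∞) ^ 2)) atTop (𝓝 0) := by
    have ht : Tendsto (fun k => tol (φ k)) atTop (𝓝 0) := htol_lim.comp hφ.tendsto_atTop
    have hcφ : Tendsto (fun k => (‖c (φ k) - c₀‖₊ : ℝ≥0∞) ^ 2) atTop (𝓝 0) := by
      have h1 : Tendsto (fun k => c (φ k) - c₀) atTop (𝓝 0) := tendsto_sub_nhds_zero_iff.2 hφlim
      have h2 : Tendsto (fun k => ‖c (φ k) - c₀‖₊) atTop (𝓝 0) := by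
        simpa using h1.nnnorm
      have h3 : Tendsto (fun k => (‖c (φ k) - c₀‖₊ : ℝ≥0∞)) atTop (𝓝 0) := by
        have h4 := ENNReal.tendsto_coe.2 h2
        simpa using h4
      have h5 : Tendsto (fun k => (‖c (φ k) - c₀‖₊ : ℝ≥0∞) ^ 2) atTop (𝓝 (0 ^ 2)) :=
        ((ENNReal.continuous_pow 2).tendsto 0).comp h3
      simpa using h5
    have h := ((ht.add ht).add ht).add hcφ
    have h6 := ENNReal.Tendsto.const_mul h (Or.inr (by norm_num : (4 : ℝ≥0∞) ≠ ⊤))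
    simpa using h6
  have hzero : ∫⁻ X, (‖Φ X - c₀ * Ψ X‖₊ : ℝ≥0∞) ^ 2 = 0 :=
    le_antisymm (ge_of_tendsto' hlim hbound) bot_le
  -- conclude a.e. equality
  have hm : Measurable fun X => (‖Φ X - c₀ * Ψ X‖₊ : ℝ≥0∞) ^ 2 :=
    ((hΦ.measurable.sub (measurable_const.mul hΨ.measurable)).nnnorm.coe_nnreal_ennreal).pow_const 2
  have hae := (lintegral_eq_zero_iff hm).1 hzero
  filter_upwards [hae] with X hX
  have h0 : (‖Φ X - c₀ * Ψ X‖₊ : ℝ≥0∞) = 0 := by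
    simpa using hX
  have h1 : Φ X - c₀ * Ψ X = 0 := by
    simpa using h0
  exact sub_eq_zero.1 h1

end Summit.AtomisticToContinuum.BoseEinsteinCondensation.Theorems.GroundStateRigidity

end
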